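import Literature.Algebra.Module.AlternatingPairingParity
import Literature.GroupTheory.FiniteAbelian.LevelwisePairingAssembly
import HarnessLib

/-!
# Route `KolyvaginRoadThree`, crux `ZhangSharpFrameAtThreeHL` (item stmt-BirchSwinnertonDyer-19574), stub P:
# the `p`-rank of `Ш[p^∞]/p` is EVEN from LEVELWISE Cassels–Tate pairings AT ONE PRIME, WITHOUT finiteness of `Ш`
# (pure algebra; cell `bsd-stepL`, seat `bsd-stepL-zhang3-w1` g0; `--supports stmt-BirchSwinnertonDyer-19574`)

The tree proves «`dim_{𝔽_p} A[p^∞]/p` is even» for a torsion group `A` with finite `A[p]` from ONE GLOBAL alternating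
pairing `B : A × A → ℚ/ℤ` with kernel the divisible elements (`Literature.Algebra.Module.even_finrank_modN_primaryComponent`
— the printed Cassels–Tate theorem `WeierstrassCurve.exists_casselsTate_pairing`, Silverman X.4.14), and separately
«`A[q] ≃ L × L`» from a LEVEL pairing `IsLevelPairing q B_q` (kernel `A[q] ∩ qA`, Milne *ADT* I 6.13(a) at a fixed
level) when the `p`-part is FINITE and killed by `q`
(`Literature.GroupTheory.FiniteAbelian.exists_addEquiv_prod_self_of_isLevelPairing_pow`, McCallum's «`Ш` finite ⇒ the
Cassels pairing is non-degenerate»). The routes of cell `bsd-stepL` carry Cassels–Tate only LEVELWISE and only at ODD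
primes (`Literature.NumberTheory.EllipticCurves.casselsTate_levelInputs`, the binder hCT3 = item 20191 of
`KolyvaginRoadThree` ∕ `ClassRecordThree` ∕ `ErratumRoadFive`; `AdditiveKolyvaginRoad` rev 18), so the all-levels
fact cannot be assembled from them (`exists_casselsTate_pairing_of_levelwise` wants every prime), and the finite-`Ш`
shape is available only behind Gross–Zagier–Kolyvagin.

This file closes the gap in general: **level pairings at the powers of ONE prime `p` on a torsion group all of whose
`n`-torsion subgroups are finite force `#(A[p^∞]/p·A[p^∞]) = p^{2m}` — no finiteness of `A[p^∞]`, no other prime.**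

* `exists_natCard_modN_eq_pow_two_mul_of_pairing` — the tree's main lemma cut down to what its proof uses: an
  abelian `p`-group `T` with finite `T[p]` and an alternating pairing ON `T` whose kernel is `⋂ⱼ pʲT` (the elements of
  infinite `p`-height inside `T`) has `#(T/pT) = p^{2m}`; proof = the tree's (`D = p^K T` is `p`-divisible for
  `K ≫ 0` (`exists_pDivisible_nsmul_map`) and is the kernel, the pairing descends to a non-degenerate alternating
  pairing on the finite `p`-group `Q = T/D`, `#Q[p] = p^{2m}` (`exists_natCard_torsionBy_eq_pow_two_mul`),
  `#(T/pT) = #(Q/pQ) = #Q[p]`).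
* `exists_natCard_modN_primaryComponent_eq_pow_two_mul_of_levelPairings` — **main result**: `A` with every `A[n]`
  (`n > 0`) finite, and for every `k ≥ 1` SOME alternating `B_k : A[p^k] × A[p^k] → ℚ/ℤ` with left kernel
  `A[p^k] ∩ p^k A` (`IsLevelPairing (p^k) B_k`; no compatibility between levels is asked) ⇒ `#(A[p^∞]/p) = p^{2m}`.
  Proof: `A = A¹ ⊕ R` for a retraction `r` onto the infinitely divisible part `A¹` (`exists_retraction_divHull`: an
  injective `ℤ`-module), the `p`-part `R_p` of `R = ker r` is killed by some `p^e` (`exists_pow_nsmul_redPPart_eq_zero`);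
  at the single level `q = p^{e+1}` the pairing `B_q(red ·, red ·)` on `T = A[p^∞]` (`red x = x − r x ∈ R_p ⊆ A[q]`
  for `x ∈ T`) is alternating with kernel exactly `⋂ⱼ pʲT`: an element of `A¹ ∩ A[q]` is `q`-divisible hence
  `B_q`-orthogonal to everything, so `B_q(red t, red T) = 0` gives `B_q(red t, A[q]) = 0`, so `red t ∈ qA`, so
  `red t = q · red z` with `red z ∈ R_p`, so `red t = 0`, so `t = r t ∈ A¹` has infinite `p`-height by `p`-primary
  elements; conversely `t ∈ p^{e+1} T` has `red t = 0`. Then the first lemma.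
* `even_finrank_modN_primaryComponent_of_levelPairings` — the `Finite ∧ Even finrank` form consumed by the Selmer-rank
  comparison (the proof of `exists_selmerRank_eq_add`).

Theorems only (no `def`, no named fact, no `sorry`); no number theory imported. Consumer: the sibling
`KolyvaginRoadThreeMethod2OddSelmerRankOfPParityLevelwise` (stub P of crux 19574 from Dokchitser–Dokchitser + the
ROUTE's levelwise binder hCT3). PARTITION: O2@3 (B10) × A1 × crux 19574 × stub P — proves-glue (algebra); closes: none.

References: [cite: MilneADT2006, Ch. I §6, Thm. 6.13(a), Lemma 6.17] [cite: Dokchitser2013ParityNotes, §2 (first display)]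
[cite: McCallumLMS1991, §5 (p. 307)] · L. Fuchs, *Infinite Abelian Groups* I, §21, §23 [folklore].
-/

noncomputable section

open scoped AddSubgroup

universe u

namespace Summit.BirchSwinnertonDyer.Rank1Residual.X11b.Three.Koly.Method2.LevelParity

open Literature.Algebra.Module Literature.GroupTheory.FiniteAbelian

variable {p : ℕ} [hp : Fact p.Prime]

omit hp in
/-- Iterated `p`-divisibility inside a `p`-divisible subgroup: every `d ∈ D` is `p^j • d'` with `d' ∈ D`. [folklore] -/
theorem exists_pow_nsmul_eq_of_pDivisible {T : Type u} [AddCommGroup T] {D : AddSubgroup T}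
    (hdiv : ∀ d ∈ D, ∃ d' ∈ D, p • d' = d) (j : ℕ) {d : T} (hd : d ∈ D) : ∃ d' ∈ D, p ^ j • d' = d := by
  induction j generalizing d with
  | zero => exact ⟨d, hd, by rw [pow_zero, one_smul]⟩
  | succ j ih =>
    obtain ⟨d₁, hd₁, rfl⟩ := hdiv d hd
    obtain ⟨d₂, hd₂, rfl⟩ := ih hd₁
    exact ⟨d₂, hd₂, by rw [pow_succ', mul_smul]⟩

/-- **`#(T/pT) = p^{2m}` for an abelian `p`-group `T` with finite `T[p]` carrying an alternating pairing with kernel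
`⋂ⱼ pʲ T`.** This is the tree's `Literature.Algebra.Module.exists_natCard_modN_primaryComponent_eq_pow_two_mul` with
the global pairing on an ambient torsion group (kernel = divisible elements) replaced by exactly what its proof consumes:
a pairing on the `p`-group itself whose kernel consists of the elements of infinite `p`-height INSIDE `T`. Proof as
there: `D = p^K T` is `p`-divisible (`exists_pDivisible_nsmul_map`) and is the kernel; `Q = T/D` is a finite `p`-group
with a non-degenerate alternating pairing, so `#Q[p] = p^{2m}` (`exists_natCard_torsionBy_eq_pow_two_mul`);
`#(T/pT) = #(Q/pQ) = #Q[p]`. [cite: Dokchitser2013ParityNotes, §2 (first display)] -/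
theorem exists_natCard_modN_eq_pow_two_mul_of_pairing {T : Type u} [AddCommGroup T]
    (hT : ∀ t : T, ∃ n : ℕ, p ^ n • t = 0) [Finite T[(p : ℤ)]]
    (BT : T →+ T →+ AddCircle (1 : ℚ)) (halt : ∀ t, BT t t = 0)
    (hker : ∀ t : T, (∀ t', BT t t' = 0) ↔ ∀ j : ℕ, ∃ s : T, p ^ j • s = t) :
    ∃ m : ℕ, Nat.card (ModN T p) = p ^ (2 * m) := by
  obtain ⟨K, hK1, hdiv⟩ := exists_pDivisible_nsmul_map (A := T) (p := p)
  have hP : ∀ t : T, t ∈ AddCommGroup.primaryComponent T p := fun t ↦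
    (AddCommGroup.mem_primaryComponent).mpr (hT t)
  set D : AddSubgroup T := (AddCommGroup.primaryComponent T p).map (nsmulAddMonoidHom (p ^ K)) with hD_def
  have hmemD : ∀ x, x ∈ D ↔ ∃ t : T, p ^ K • t = x := fun x ↦ by
    simp only [hD_def, AddSubgroup.mem_map, nsmulAddMonoidHom_apply]
    exact ⟨fun ⟨t, _, ht⟩ ↦ ⟨t, ht⟩, fun ⟨t, ht⟩ ↦ ⟨t, hP t, ht⟩⟩
  -- `D` is in the kernel of `BT`, and the kernel of `BT` is `D`
  have hDrad : ∀ d ∈ D, ∀ t' : T, BT d t' = 0 := fun d hd ↦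
    (hker d).mpr fun j ↦ by
      obtain ⟨d', -, hd'eq⟩ := exists_pow_nsmul_eq_of_pDivisible hdiv j hd
      exact ⟨d', hd'eq⟩
  have hradD : ∀ t : T, (∀ t' : T, BT t t' = 0) → t ∈ D := fun t h ↦ by
    obtain ⟨s, hs⟩ := (hker t).mp h K
    exact (hmemD _).mpr ⟨s, hs⟩
  -- `Q[p]` is the image of `T[p]`, hence finite; `p ^ K` kills `Q = T/D`, hence `Q` is finite
  haveI : Finite (T ⧸ D)[(p : ℤ)] := by
    let g : T[(p : ℤ)] → (T ⧸ D)[(p : ℤ)] := fun s ↦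
      ⟨((s : T) : T ⧸ D), AddSubgroup.torsionBy.nsmul_iff.mpr (by
        rw [← QuotientAddGroup.mk_nsmul, QuotientAddGroup.eq_zero_iff, AddSubgroup.torsionBy.nsmul_iff.mp s.2]
        exact zero_mem _)⟩
    refine Finite.of_surjective g fun q ↦ ?_
    obtain ⟨q, hq⟩ := q
    obtain ⟨t, rfl⟩ := QuotientAddGroup.mk_surjective q
    have hpt : p • t ∈ D := by
      have h := AddSubgroup.torsionBy.nsmul_iff.mp hq
      rwa [← QuotientAddGroup.mk_nsmul, QuotientAddGroup.eq_zero_iff] at h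
    obtain ⟨d', hd', hd'eq⟩ := hdiv _ hpt
    have hs : t - d' ∈ T[(p : ℤ)] := by
      rw [AddSubgroup.torsionBy.nsmul_iff, smul_sub, hd'eq, sub_self]
    refine ⟨⟨t - d', hs⟩, Subtype.ext ?_⟩
    change (((t - d' : T) : T ⧸ D)) = (t : T ⧸ D)
    rw [QuotientAddGroup.mk_sub, sub_eq_self, QuotientAddGroup.eq_zero_iff]
    exact hd'
  have hQK : ∀ q : T ⧸ D, p ^ K • q = 0 := fun q ↦ by
    obtain ⟨t, rfl⟩ := QuotientAddGroup.mk_surjective q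
    rw [← QuotientAddGroup.mk_nsmul, QuotientAddGroup.eq_zero_iff]
    exact (hmemD _).mpr ⟨t, rfl⟩
  haveI : Finite (T ⧸ D) := finite_of_prime_pow_nsmul_eq_zero (T ⧸ D) p K hQK
  have hQprim : ∀ q : T ⧸ D, ∃ n : ℕ, p ^ n • q = 0 := fun q ↦ ⟨K, hQK q⟩
  -- the pairing descends to `Q`
  obtain ⟨BQ, hBQ⟩ : ∃ BQ : (T ⧸ D) →+ (T ⧸ D) →+ AddCircle (1 : ℚ),
      ∀ t t' : T, BQ (t : T ⧸ D) (t' : T ⧸ D) = BT t t' := by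
    have hkill₂ : ∀ t : T, D ≤ (BT t).ker := fun t d hd ↦ by
      rw [AddMonoidHom.mem_ker, apply_apply_eq_neg BT halt, neg_eq_zero]
      exact hDrad _ hd _
    let B₁ : T →+ ((T ⧸ D) →+ AddCircle (1 : ℚ)) :=
      AddMonoidHom.mk' (fun t ↦ QuotientAddGroup.lift D (BT t) (hkill₂ t)) (by
        intro t t'
        apply QuotientAddGroup.addMonoidHom_ext
        ext v
        simp only [AddMonoidHom.coe_comp, Function.comp_apply, QuotientAddGroup.mk'_apply,
          AddMonoidHom.add_apply, QuotientAddGroup.lift_mk, map_add])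
    have hB₁ : ∀ t t' : T, B₁ t (t' : T ⧸ D) = BT t t' := fun t t' ↦
      QuotientAddGroup.lift_mk D (hkill₂ t) t'
    have hkill₁ : D ≤ B₁.ker := fun d hd ↦ by
      rw [AddMonoidHom.mem_ker]
      apply QuotientAddGroup.addMonoidHom_ext
      ext v
      rw [AddMonoidHom.coe_comp, Function.comp_apply, QuotientAddGroup.mk'_apply, hB₁,
        AddMonoidHom.zero_comp, AddMonoidHom.zero_apply]
      exact hDrad _ hd _
    exact ⟨QuotientAddGroup.lift D B₁ hkill₁, fun t t' ↦ by
      rw [QuotientAddGroup.lift_mk D hkill₁ t, hB₁]⟩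
  have hQalt : ∀ q : T ⧸ D, BQ q q = 0 := fun q ↦ by
    obtain ⟨t, rfl⟩ := QuotientAddGroup.mk_surjective q
    rw [hBQ]
    exact halt t
  have hQnd : ∀ q : T ⧸ D, (∀ q', BQ q q' = 0) → q = 0 := by
    intro q hq
    obtain ⟨t, rfl⟩ := QuotientAddGroup.mk_surjective q
    rw [QuotientAddGroup.eq_zero_iff]
    refine hradD t fun t' ↦ ?_
    have h := hq (t' : T ⧸ D)
    rwa [hBQ] at h
  obtain ⟨m, hm⟩ := exists_natCard_torsionBy_eq_pow_two_mul hQprim BQ hQalt hQnd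
  refine ⟨m, ?_⟩
  rw [← hm]
  -- `#(T/pT) = #(Q/pQ) = #Q[p]`
  set M : AddSubgroup T := (LinearMap.range (LinearMap.lsmul ℤ T p)).toAddSubgroup with hM_def
  have hmemM : ∀ t : T, t ∈ M ↔ ∃ t' : T, p • t' = t := fun t ↦ by
    simp only [hM_def, Submodule.mem_toAddSubgroup, LinearMap.mem_range, LinearMap.lsmul_apply,
      Nat.cast_smul_eq_nsmul]
  have hle : D ≤ M := fun d hd ↦ by
    obtain ⟨d', -, hd'eq⟩ := hdiv _ hd
    exact (hmemM d).mpr ⟨d', hd'eq⟩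
  set ψ : (T ⧸ D) →+ (T ⧸ D) := nsmulAddMonoidHom p with hψ_def
  have hmap : M.map (QuotientAddGroup.mk' D) = ψ.range := by
    ext q
    constructor
    · rintro ⟨t, ht, rfl⟩
      obtain ⟨t', rfl⟩ := (hmemM t).mp ht
      exact ⟨(t' : T ⧸ D), by
        rw [hψ_def, nsmulAddMonoidHom_apply, QuotientAddGroup.mk'_apply, QuotientAddGroup.mk_nsmul]⟩
    · rintro ⟨q', rfl⟩
      obtain ⟨t', rfl⟩ := QuotientAddGroup.mk_surjective q'
      exact ⟨p • t', (hmemM _).mpr ⟨t', rfl⟩, by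
        rw [hψ_def, nsmulAddMonoidHom_apply, QuotientAddGroup.mk'_apply, QuotientAddGroup.mk_nsmul]⟩
  have e : ModN T p ≃+ (T ⧸ D) ⧸ ψ.range :=
    ((QuotientAddGroup.quotientQuotientEquivQuotient D M hle).symm).trans
      (QuotientAddGroup.quotientAddEquivOfEq hmap)
  rw [Nat.card_congr e.toEquiv]
  -- `#Q = #Q[p] · #pQ = #pQ · #(Q/pQ)`
  have hkerψ : ψ.ker = (T ⧸ D)[(p : ℤ)] := by
    ext q
    rw [AddMonoidHom.mem_ker, hψ_def, nsmulAddMonoidHom_apply, AddSubgroup.torsionBy.nsmul_iff]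
  have h1 : Nat.card (T ⧸ D) = Nat.card (T ⧸ D)[(p : ℤ)] * Nat.card ψ.range := by
    rw [← hkerψ, AddSubgroup.card_eq_card_quotient_mul_card_addSubgroup ψ.ker, mul_comm,
      Nat.card_congr (QuotientAddGroup.quotientKerEquivRange ψ).toEquiv]
  have h2 : Nat.card (T ⧸ D) = Nat.card ((T ⧸ D) ⧸ ψ.range) * Nat.card ψ.range :=
    AddSubgroup.card_eq_card_quotient_mul_card_addSubgroup ψ.range
  have hpos : 0 < Nat.card ψ.range := Nat.card_pos
  exact Nat.eq_of_mul_eq_mul_right hpos (h2.symm.trans h1)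

variable {A : Type u} [AddCommGroup A]

omit hp in
/-- `A[p^∞][p]` is finite when `A[p]` is (the same elements). [folklore] -/
theorem finite_torsionBy_primaryComponent [Finite A[(p : ℤ)]] :
    Finite (AddCommGroup.primaryComponent A p)[(p : ℤ)] := by
  refine Finite.of_injective (fun x : (AddCommGroup.primaryComponent A p)[(p : ℤ)] ↦
    (⟨((x : AddCommGroup.primaryComponent A p) : A), AddSubgroup.torsionBy.nsmul_iff.mpr ?_⟩ : A[(p : ℤ)])) ?_
  · rw [← AddSubgroupClass.coe_nsmul, AddSubgroup.torsionBy.nsmul_iff.mp x.2, ZeroMemClass.coe_zero]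
  · intro x y hxy
    exact Subtype.ext (Subtype.ext (congrArg (fun z : A[(p : ℤ)] ↦ (z : A)) hxy))

/-- **MAIN RESULT — `#(A[p^∞]/p) = p^{2m}` from level pairings at the powers of ONE prime, without finiteness of
`A[p^∞]`.** Let `A` be an abelian group all of whose torsion subgroups `A[n]` (`n > 0`) are finite (e.g.
`A = Ш(E/K)`: `finite_sha_torsionBy_holds`), `p` a prime, and suppose that for every `k ≥ 1` there is an alternating
bi-additive `B_k : A[p^k] × A[p^k] → ℚ/ℤ` whose left kernel is `A[p^k] ∩ p^k A` (`IsLevelPairing`; for `Ш` this is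
Milne's FIXED-LEVEL Cassels–Tate theorem, the fourth output of the tree's `casselsTate_levelInputs`). Then `T = A[p^∞]`
has `#(T/pT) = p^{2m}`. Proof: `A = A¹ ⊕ R` (`exists_retraction_divHull`), the `p`-part `R_p` of `R` is killed by
some `p^e` (`exists_pow_nsmul_redPPart_eq_zero`); at the ONE level `q = p^{e+1}` the pairing
`(t, t') ↦ B_q(red t, red t')` on `T` is alternating with kernel `⋂ⱼ pʲ T`, and
`exists_natCard_modN_eq_pow_two_mul_of_pairing` applies. Only the level `p^{e+1}` is used, but `e` is not a priori
bounded, whence the hypothesis at all levels. [cite: MilneADT2006, Ch. I §6, Thm. 6.13(a)]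
[cite: Dokchitser2013ParityNotes, §2 (first display)] -/
theorem exists_natCard_modN_primaryComponent_eq_pow_two_mul_of_levelPairings
    (hfin : ∀ n : ℕ, 0 < n → (A[(n : ℤ)] : Set A).Finite)
    (hlev : ∀ k : ℕ, 0 < k →
      ∃ B : A[((p ^ k : ℕ) : ℤ)] →+ A[((p ^ k : ℕ) : ℤ)] →+ AddCircle (1 : ℚ), IsLevelPairing (p ^ k) B) :
    ∃ m : ℕ, Nat.card (ModN (AddCommGroup.primaryComponent A p) p) = p ^ (2 * m) := by
  haveI : Finite A[(p : ℤ)] := (hfin p hp.out.pos).to_subtype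
  haveI : Finite (AddCommGroup.primaryComponent A p)[(p : ℤ)] := finite_torsionBy_primaryComponent
  set T : AddSubgroup A := AddCommGroup.primaryComponent A p with hT_def
  have hTp : ∀ t : T, ∃ n : ℕ, p ^ n • t = 0 := fun t ↦ by
    obtain ⟨n, hn⟩ := (AddCommGroup.mem_primaryComponent).mp t.2
    exact ⟨n, Subtype.ext (by rw [AddSubgroupClass.coe_nsmul, hn, ZeroMemClass.coe_zero])⟩
  -- `A = A¹ ⊕ R`, `R_p` killed by `p ^ e`
  obtain ⟨r, hr⟩ := exists_retraction_divHull (G := A) hfin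
  obtain ⟨e, he⟩ := exists_pow_nsmul_redPPart_eq_zero (r := r) (p := p) hr hp.out hfin
  set k : ℕ := e + 1 with hk_def
  obtain ⟨B, hB⟩ := hlev k (Nat.succ_pos e)
  -- `red t ∈ R_p ⊆ A[p ^ k]` for `t ∈ T`
  have hredT : ∀ t : A, t ∈ T → red r t ∈ redPPart r p := fun t ht ↦ by
    obtain ⟨n, hn⟩ := (AddCommGroup.mem_primaryComponent).mp ht
    refine (mem_redPPart_iff r p).mpr ⟨r_red hr t, n, ?_⟩
    rw [← redHom_apply, ← map_nsmul, hn, map_zero]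
  have hredk : ∀ x ∈ redPPart r p, p ^ k • x = 0 := fun x hx ↦ by
    rw [hk_def, pow_succ', mul_smul, he x hx, smul_zero]
  have hredq : ∀ t : T, red r (t : A) ∈ A[((p ^ k : ℕ) : ℤ)] := fun t ↦
    AddSubgroup.torsionBy.nsmul_iff.mpr (hredk _ (hredT _ t.2))
  -- the pairing `BT (t, t') = B (red t, red t')` on `T`
  let ρ : T →+ A[((p ^ k : ℕ) : ℤ)] :=
    ((redHom r).comp T.subtype).codRestrict _ fun t ↦ hredq t
  have hρ : ∀ t : T, ((ρ t : A[((p ^ k : ℕ) : ℤ)]) : A) = red r (t : A) := fun _ ↦ rfl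
  let BT : T →+ T →+ AddCircle (1 : ℚ) := (B.comp ρ).compl₂ ρ
  have hBT : ∀ t t' : T, BT t t' = B (ρ t) (ρ t') := fun _ _ ↦ rfl
  have halt : ∀ t, BT t t = 0 := fun t ↦ by rw [hBT]; exact hB.1 _
  -- elements of `A¹ ∩ A[q]` are `B`-orthogonal to everything
  have hdivKer : ∀ y : A[((p ^ k : ℕ) : ℤ)], (y : A) ∈ divHull A → ∀ x, B x y = 0 := by
    intro y hy x
    have hq0 : 0 < p ^ k := pow_pos hp.out.pos k
    have hleft : ∀ x', B y x' = 0 := (hB.2 y).mpr ((mem_divHull_iff (y : A)).mp hy (p ^ k) hq0)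
    rw [apply_apply_eq_neg B hB.1, hleft, neg_zero]
  -- the kernel of `BT` is `⋂ⱼ pʲ T`
  have hker : ∀ t : T, (∀ t', BT t t' = 0) ↔ ∀ j : ℕ, ∃ s : T, p ^ j • s = t := by
    intro t
    constructor
    · intro h
      -- `B (red t, A[q]) = 0`
      have hall : ∀ y : A[((p ^ k : ℕ) : ℤ)], B (ρ t) y = 0 := by
        intro y
        have hyT : (y : A) ∈ T := (AddCommGroup.mem_primaryComponent).mpr
          ⟨k, AddSubgroup.torsionBy.nsmul_iff.mp y.2⟩
        have hry : ((r y : A)) ∈ A[((p ^ k : ℕ) : ℤ)] := by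
          refine AddSubgroup.torsionBy.nsmul_iff.mpr ?_
          rw [← AddSubgroupClass.coe_nsmul, ← map_nsmul, AddSubgroup.torsionBy.nsmul_iff.mp y.2, map_zero,
            ZeroMemClass.coe_zero]
        have hdec : y = ⟨(r y : A), hry⟩ + ρ ⟨y, hyT⟩ :=
          Subtype.ext (by
            rw [AddSubgroup.coe_add, hρ]
            exact (coe_r_add_red (r := r) (y : A)).symm)
        rw [hdec, map_add, hdivKer ⟨(r y : A), hry⟩ (r y).2, zero_add, ← hBT]
        exact h ⟨y, hyT⟩
      -- hence `red t ∈ qA`, hence `red t = 0`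
      obtain ⟨z, hz⟩ := (hB.2 (ρ t)).mp hall
      rw [hρ] at hz
      obtain ⟨n, hn⟩ := (AddCommGroup.mem_primaryComponent).mp t.2
      have h1 : p ^ k • red r z = red r (t : A) := by
        rw [← redHom_apply, ← map_nsmul, hz, redHom_apply, red_eq_self_of_r_eq_zero (r_red hr _)]
      have h2 : p ^ n • red r (t : A) = 0 := by
        rw [← redHom_apply, ← map_nsmul, hn, map_zero]
      have hrz : red r z ∈ redPPart r p := by
        refine (mem_redPPart_iff r p).mpr ⟨r_red hr z, n + k, ?_⟩
        rw [pow_add, mul_smul, h1, h2]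
      have hred0 : red r (t : A) = 0 := by rw [← h1, hredk _ hrz]
      -- so `t = r t ∈ A¹` has infinite `p`-height by `p`-primary elements
      have htdiv : (t : A) ∈ divHull A := by
        have h3 := coe_r_add_red (r := r) (t : A)
        rw [hred0, add_zero] at h3
        rw [← h3]
        exact (r t).2
      intro j
      obtain ⟨y, hy⟩ := (mem_divHull_iff (t : A)).mp htdiv (p ^ j) (pow_pos hp.out.pos j)
      have hyT : y ∈ T := (AddCommGroup.mem_primaryComponent).mpr
        ⟨n + j, by rw [pow_add, mul_smul, hy, hn]⟩
      exact ⟨⟨y, hyT⟩, Subtype.ext (by rw [AddSubgroupClass.coe_nsmul]; exact hy)⟩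
    · intro h t'
      obtain ⟨s, hs⟩ := h k
      have hρt : ρ t = 0 := Subtype.ext (by
        rw [hρ, ZeroMemClass.coe_zero, ← hs, AddSubgroupClass.coe_nsmul, ← redHom_apply, map_nsmul,
          redHom_apply]
        exact hredk _ (hredT _ s.2))
      rw [hBT, hρt, map_zero, AddMonoidHom.zero_apply]
  exact exists_natCard_modN_eq_pow_two_mul_of_pairing hTp BT halt hker

/-- **Evenness of `dim_{𝔽_p} A[p^∞]/p` from level pairings at one prime** (the `Finite ∧ Even finrank` form of
`exists_natCard_modN_primaryComponent_eq_pow_two_mul_of_levelPairings`, as consumed by the Selmer-rank comparison).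
[cite: Dokchitser2013ParityNotes, §2 (first display)] -/
theorem even_finrank_modN_primaryComponent_of_levelPairings
    (hfin : ∀ n : ℕ, 0 < n → (A[(n : ℤ)] : Set A).Finite)
    (hlev : ∀ k : ℕ, 0 < k →
      ∃ B : A[((p ^ k : ℕ) : ℤ)] →+ A[((p ^ k : ℕ) : ℤ)] →+ AddCircle (1 : ℚ), IsLevelPairing (p ^ k) B) :
    Finite (ModN (AddCommGroup.primaryComponent A p) p) ∧
      Even (Module.finrank (ZMod p) (ModN (AddCommGroup.primaryComponent A p) p)) := by
  obtain ⟨m, hm⟩ := exists_natCard_modN_primaryComponent_eq_pow_two_mul_of_levelPairings (p := p) hfin hlev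
  haveI : Finite (ModN (AddCommGroup.primaryComponent A p) p) :=
    Nat.finite_of_card_ne_zero (by rw [hm]; exact pow_ne_zero _ hp.out.ne_zero)
  haveI : Module.Finite (ZMod p) (ModN (AddCommGroup.primaryComponent A p) p) :=
    Module.Finite.of_finite
  refine ⟨‹_›, m, ?_⟩
  have h := Module.natCard_eq_pow_finrank (K := ZMod p)
    (V := ModN (AddCommGroup.primaryComponent A p) p)
  rw [hm, Nat.card_zmod] at h
  have := Nat.pow_right_injective hp.out.two_le h
  omega

end Summit.BirchSwinnertonDyer.Rank1Residual.X11b.Three.Koly.Method2.LevelParity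

end
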